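import Summits.QuantumFields.YangMills.Theorems.AllWindowsColdBoxDirProjKernelContraction
import Summits.QuantumFields.YangMills.Theorems.AllWindowsColdBoxBoxHighLineCaccioppoliIdentity
import Summits.QuantumFields.YangMills.Theorems.AllWindowsColdBoxBoxHighLineLandauBallSums

/-!
# LINE-20 U1 / LINE-19 S3, structure lemmas T-U1.P and T-U1.G (planner ym-idea-2 g17, STUB-PLAN-U1 rev 2 §6.5)

Crux `AllWindowsColdBox.BoxWindowHighSU2213` ⟨stmt-QuantumFields-24336⟩ (parent ⟨24004⟩, low ⟨24335⟩).  Two exact identities behind the kernel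
package (U1) and the dipole kernel of U1c/U5:

* **T-U1.P — the Dirichlet projection kernel IS a projection.**  For ANY positive-definite pinned lattice-Maxwell precision matrix
  `Q = Σ_r λ_rλ_rᵀ` (`LatticeMaxwell.Qmat pin a n`): `Σ_r (v·Q⁻¹λ_r)(λ_r·Q⁻¹w) = v·Q⁻¹w` (`dotProduct_inv_sum_coeff_idem`); hence for the cold box
  `Σ_{r} K(p,r)K(r,q) = K(p,q)` for `K = boxDirProjKernel H` summed over the plaquettes of the enlarged block (`boxDirProjKernel_idem`; symmetry is the tree's `boxDirProjKernel_comm`), the diagonal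
  is the ℓ²-row `K(p,p) = Σ_r K(p,r)²` (`boxDirProjKernel_diag_eq_sum_sq`), so `Σ_r K(p,r)² ≤ 1` (`sum_boxDirProjKernel_sq_le_one`, with the tree's
  `K(p,p) ≤ 1`); and the SAME identities for LINE-19's Hodge presentation `K(p,q) = λ_pᵀ hodgeQ⁻¹ λ_q` over `hodgePlaqs H` (by S2 ✓`stub_kernelHodgeForm`):
  `hodgeKernel_idem`, `hodgeKernel_diag_eq_sum_sq`.
* **T-U1.G — the Hodge columns `u_q = hodgeQ⁻¹λ_q` are divergence-free at the interior sites**: `g_x · hodgeQ⁻¹λ_q = 0`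
  (`gradVec_dotProduct_inv_mulVec_landauCoeff`), via the curl-freeness `λ_r · g_x = 0` (tree ✓`coeff_dotProduct_grad_eq_zero`), the Gram matrix of
  the gauge modes and their linear independence (`gradVec_linearIndependent_aux`, from the Dirichlet Poincaré inequality ✓`LandauBall.sum_sq_le_poincare`).
  Consequently the Hodge bilinear form of two columns is the kernel: `Σ_r (λ_r·u_p)(λ_r·u_q) = λ_p·u_q` (`sum_landauCoeff_col_mul_col`).

Everything proved; no definitions; standard axioms.  HONEST LABEL: bookkeeping toward the kernel stubs of two critic-stamped DRAFT lines on the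
R2ξ″ crux; no stub is proved by name here, no crux, rung or summit is proved; the Yang–Mills mass gap is NOT proved by this file.
-/

set_option autoImplicit false

noncomputable section

open Finset Matrix
open Literature.MathematicalPhysics.QuantumFieldTheory
open Literature.MathematicalPhysics.QuantumFieldTheory.LatticeMaxwell
open Literature.MathematicalPhysics.QuantumFieldTheory.AxialGauge
open Literature.Probability.LatticeModels (Site halfOpenBox)

/-! ## T-U1.P, generic form: `Λᵀ Q⁻¹ Λ` is idempotent for `Q = ΛΛᵀ` positive definite -/

namespace Summit.QuantumFields.YangMills.Theorems.WeakCouplingRates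

section General

variable {d : ℕ} {pin : Literature.MathematicalPhysics.QuantumLattice.ZdEdge d → Prop} [DecidablePred pin]
  {a : Literature.Probability.LatticeModels.Site d} {n : ℕ}

/-- The bilinear form of `Qmat`: `u·(Q u') = Σ_r (λ_r·u)(λ_r·u')`. -/
theorem dotProduct_Qmat_mulVec_eq_sum (u u' : Free pin a n → ℝ) :
    u ⬝ᵥ (Qmat pin a n *ᵥ u') =
      ∑ r ∈ plaquettesIn (halfOpenBox d n), (coeff pin a n (Plaq.shift a r) ⬝ᵥ u) * (coeff pin a n (Plaq.shift a r) ⬝ᵥ u') := by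
  rw [Qmat, Matrix.sum_mulVec, dotProduct_sum]
  refine Finset.sum_congr rfl fun r _ => ?_
  have h1 : vecMulVec (coeff pin a n (Plaq.shift a r)) (coeff pin a n (Plaq.shift a r)) *ᵥ u' =
      (coeff pin a n (Plaq.shift a r) ⬝ᵥ u') • coeff pin a n (Plaq.shift a r) := by
    ext i
    simp only [Matrix.mulVec, vecMulVec_apply, dotProduct, Pi.smul_apply, smul_eq_mul, Finset.sum_mul]
    exact Finset.sum_congr rfl fun j _ => by ring
  rw [h1, dotProduct_smul, smul_eq_mul, dotProduct_comm u, mul_comm]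

/-- `Q⁻¹` is symmetric, in the form `v·Q⁻¹w = (Q⁻¹v)·w`. -/
theorem dotProduct_inv_mulVec_comm (v w : Free pin a n → ℝ) :
    v ⬝ᵥ ((Qmat pin a n)⁻¹ *ᵥ w) = ((Qmat pin a n)⁻¹ *ᵥ v) ⬝ᵥ w := by
  rw [dotProduct_mulVec, ← Matrix.mulVec_transpose, Matrix.transpose_nonsing_inv, Qmat_transpose]

/-- **T-U1.P (generic).**  For positive definite `Q = Σ_r λ_rλ_rᵀ`: `Σ_r (v·Q⁻¹λ_r)(λ_r·Q⁻¹w) = v·Q⁻¹w` — the kernel `(v,w) ↦ v·Q⁻¹w`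
restricted to the `λ`'s is an idempotent (the orthogonal projection onto the span of the `λ_r` in the `Q⁻¹` geometry). -/
theorem dotProduct_inv_sum_coeff_idem (hQ : (Qmat pin a n).PosDef) (v w : Free pin a n → ℝ) :
    ∑ r ∈ plaquettesIn (halfOpenBox d n),
        (v ⬝ᵥ ((Qmat pin a n)⁻¹ *ᵥ coeff pin a n (Plaq.shift a r))) * (coeff pin a n (Plaq.shift a r) ⬝ᵥ ((Qmat pin a n)⁻¹ *ᵥ w)) =
      v ⬝ᵥ ((Qmat pin a n)⁻¹ *ᵥ w) := by
  set Q := Qmat pin a n with hQdef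
  have hdet : IsUnit Q.det := (isUnit_iff_isUnit_det Q).1 hQ.isUnit
  have hQw : Q *ᵥ (Q⁻¹ *ᵥ w) = w := by rw [mulVec_mulVec, mul_nonsing_inv _ hdet, one_mulVec]
  have h1 : ∀ r, v ⬝ᵥ (Q⁻¹ *ᵥ coeff pin a n (Plaq.shift a r)) = coeff pin a n (Plaq.shift a r) ⬝ᵥ (Q⁻¹ *ᵥ v) := by
    intro r; rw [dotProduct_inv_mulVec_comm, dotProduct_comm]
  simp only [h1]
  rw [← dotProduct_Qmat_mulVec_eq_sum, hQw, ← dotProduct_inv_mulVec_comm]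

end General

/-! ## T-U1.P for the cold box: `boxDirProjKernel H` is idempotent -/

variable (H : ℕ)

/-- **`K² = K`** for the Dirichlet projection kernel of the cold box, summed over the plaquettes of the enlarged block. -/
theorem boxDirProjKernel_idem (p q : Plaq 4) :
    ∑ r ∈ plaquettesIn (halfOpenBox 4 (2 * H + 3)),
        boxDirProjKernel H p (Plaq.shift dirCorner r) * boxDirProjKernel H (Plaq.shift dirCorner r) q = boxDirProjKernel H p q := by
  unfold boxDirProjKernel
  exact dotProduct_inv_sum_coeff_idem (posDef_dirQmat H) _ _

/-- **The diagonal is the ℓ²-row**: `K(p,p) = Σ_r K(p,r)²`. -/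
theorem boxDirProjKernel_diag_eq_sum_sq (p : Plaq 4) :
    boxDirProjKernel H p p = ∑ r ∈ plaquettesIn (halfOpenBox 4 (2 * H + 3)), boxDirProjKernel H p (Plaq.shift dirCorner r) ^ 2 := by
  -- symmetry `K(r,p) = K(p,r)` from the symmetry of `Q⁻¹` (the tree's `SoftLoopLongLag.boxDirProjKernel_comm` proves it via the Gaussian)
  have hsymm : ∀ r : Plaq 4, boxDirProjKernel H r p = boxDirProjKernel H p r := fun r => by
    unfold boxDirProjKernel
    rw [dotProduct_inv_mulVec_comm, dotProduct_comm]
  rw [← boxDirProjKernel_idem H p p]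
  exact Finset.sum_congr rfl fun r _ => by rw [hsymm (Plaq.shift dirCorner r), sq]

/-- **ℓ²-row bound**: `Σ_r K(p,r)² ≤ 1` for a plaquette of the enlarged block (`K(p,p) ≤ 1`). -/
theorem sum_boxDirProjKernel_sq_le_one {p : Plaq 4} (hp : p ∈ plaquettesIn (halfOpenBox 4 (2 * H + 3))) :
    ∑ r ∈ plaquettesIn (halfOpenBox 4 (2 * H + 3)), boxDirProjKernel H (Plaq.shift dirCorner p) (Plaq.shift dirCorner r) ^ 2 ≤ 1 := by
  rw [← boxDirProjKernel_diag_eq_sum_sq]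
  exact boxDirProjKernel_le_one_of_mem hp hp

/-- `K(p,q)² ≤ K(p,p)·1 ≤ 1`-type off-diagonal bound from the row identity: `K(p,q)² ≤ K(p,p)` for `q` in the block. -/
theorem boxDirProjKernel_sq_le_diag (p : Plaq 4) {q : Plaq 4} (hq : q ∈ plaquettesIn (halfOpenBox 4 (2 * H + 3))) :
    boxDirProjKernel H p (Plaq.shift dirCorner q) ^ 2 ≤ boxDirProjKernel H p p := by
  rw [boxDirProjKernel_diag_eq_sum_sq]
  exact Finset.single_le_sum (f := fun r => boxDirProjKernel H p (Plaq.shift dirCorner r) ^ 2) (fun r _ => sq_nonneg _) hq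

end Summit.QuantumFields.YangMills.Theorems.WeakCouplingRates

/-! ## T-U1.G and T-U1.P in the Hodge (Landau) presentation of LINE-19 -/

namespace Summit.QuantumFields.YangMills.Theorems.AllWindowsColdBoxBoxHighLine

open Summit.QuantumFields.YangMills.Theorems.WeakCouplingRates

variable {H : ℕ}

/-- Curl-freeness of the gauge modes in the line's vocabulary: `λ_p · g_x = 0` for interior `x`. -/
theorem landauCoeff_dotProduct_gradVec_eq_zero (p : Plaq 4) {x : Site 4} (hx : x ∈ interiorSites H) :
    landauCoeff H p ⬝ᵥ gradVec H x = 0 :=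
  Summit.QuantumFields.YangMills.Theorems.AllWindowsColdBox.HodgeForm.coeff_dotProduct_grad_eq_zero (pinL := landauPin H)
    (fun _ => Iff.rfl) ((interiorSites_iff H x).1 hx) (gradVec H x) (fun _ => rfl) p

/-- The gauge part of a field evaluated on a free edge: `(Σ_{x∈I} f_x g_x)(e) = f̃(tip) − f̃(base)`, `f̃ = f·𝟙_I`. -/
theorem sum_smul_gradVec_apply (f : Site 4 → ℝ) (e : LandauFree H) :
    (∑ x ∈ interiorSites H, f x • gradVec H x) e =
      (if e.1.1.1 + Pi.single e.1.1.2 1 ∈ interiorSites H then f (e.1.1.1 + Pi.single e.1.1.2 1) else 0) -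
        (if e.1.1.1 ∈ interiorSites H then f e.1.1.1 else 0) := by
  rw [Finset.sum_apply]
  simp only [Pi.smul_apply, smul_eq_mul, gradVec, mul_sub, mul_ite, mul_one, mul_zero, Finset.sum_sub_distrib]
  rw [Finset.sum_ite_eq, Finset.sum_ite_eq]

/-- **Linear independence of the gauge modes**: if `Σ_{x∈I} f_x g_x` vanishes on every free edge then `f = 0` on the interior
(Dirichlet Poincaré inequality of the cold box). -/
theorem eq_zero_of_sum_smul_gradVec_eq_zero (f : Site 4 → ℝ) (h0 : ∀ e : LandauFree H, (∑ x ∈ interiorSites H, f x • gradVec H x) e = 0)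
    {x : Site 4} (hx : x ∈ interiorSites H) : f x = 0 := by
  classical
  set g : Site 4 → ℝ := fun z => if z ∈ interiorSites H then f z else 0 with hg
  have hg0 : ∀ z, z ∉ interiorSites H → g z = 0 := fun z hz => by simp [hg, hz]
  have hP := LandauBall.sum_sq_le_poincare (H := H) g hg0
  have hE : ∑ e ∈ boxEdges 4 (2 * H + 1), (g (e.1 + Pi.single e.2 1) - g e.1) ^ 2 = 0 := by
    refine Finset.sum_eq_zero fun e he => ?_
    have hmem : e ∈ boxEdgesAt dirCorner (2 * H + 3) := boxEdges_subset_boxEdgesAt_dirCorner H he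
    have hfree : ¬ landauPin H e := by simp [landauPin, he]
    have h := h0 ⟨⟨e, hmem⟩, hfree⟩
    rw [sum_smul_gradVec_apply] at h
    have : g (e.1 + Pi.single e.2 1) - g e.1 = 0 := by simpa [hg] using h
    rw [this]; ring
  rw [hE, mul_zero] at hP
  have hsq : g x ^ 2 = 0 := by
    have hle : g x ^ 2 ≤ ∑ z ∈ interiorSites H, g z ^ 2 :=
      Finset.single_le_sum (f := fun z => g z ^ 2) (fun z _ => sq_nonneg _) hx
    nlinarith [sq_nonneg (g x)]
  have : g x = 0 := pow_eq_zero_iff (n := 2) (by norm_num) |>.1 hsq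
  simpa [hg, hx] using this

/-- **T-U1.G: the Hodge columns are divergence-free at the interior sites**: `g_x · hodgeQ⁻¹ λ_q = 0` for every interior `x` and every
plaquette `q` (apply `g_x ·` to `hodgeQ u = λ_q`: the plaquette part dies by curl-freeness, leaving the Gram system
`Σ_y (g_x·g_y)(g_y·u) = 0`, whose only solution is zero by linear independence of the gauge modes). -/
theorem gradVec_dotProduct_inv_mulVec_landauCoeff (q : Plaq 4) {x : Site 4} (hx : x ∈ interiorSites H) :
    gradVec H x ⬝ᵥ ((hodgeQ H)⁻¹ *ᵥ landauCoeff H q) = 0 := by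
  classical
  set u := (hodgeQ H)⁻¹ *ᵥ landauCoeff H q with hu
  have hQu : hodgeQ H *ᵥ u = landauCoeff H q := by
    rw [hu, mulVec_mulVec, mul_nonsing_inv _ (isUnit_hodgeQ_det H), one_mulVec]
  -- the Gram system: Σ_y (g_y·g_z)(g_y·u) = 0 for every interior z
  have hgram : ∀ z ∈ interiorSites H, ∑ y ∈ interiorSites H, (gradVec H y ⬝ᵥ gradVec H z) * (gradVec H y ⬝ᵥ u) = 0 := by
    intro z hz
    have h := dotProduct_hodgeQ_mulVec (gradVec H z) u
    rw [hQu, dotProduct_comm, landauCoeff_dotProduct_gradVec_eq_zero q hz] at h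
    have hplaq : ∑ p ∈ hodgePlaqs H, (landauCoeff H p ⬝ᵥ gradVec H z) * (landauCoeff H p ⬝ᵥ u) = 0 :=
      Finset.sum_eq_zero fun p _ => by rw [landauCoeff_dotProduct_gradVec_eq_zero p hz, zero_mul]
    rw [hplaq, zero_add] at h
    rw [h]
  -- the field v = Σ_y (g_y·u) g_y has v·v = 0
  set φ : Site 4 → ℝ := fun y => gradVec H y ⬝ᵥ u with hφ
  set v : LandauFree H → ℝ := ∑ y ∈ interiorSites H, φ y • gradVec H y with hv
  have hvz : ∀ z ∈ interiorSites H, gradVec H z ⬝ᵥ v = 0 := by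
    intro z hz
    rw [hv, dotProduct_sum]
    simp only [dotProduct_smul, smul_eq_mul]
    rw [← hgram z hz]
    exact Finset.sum_congr rfl fun y _ => by rw [dotProduct_comm]; ring
  have hvv : v ⬝ᵥ v = 0 := by
    conv_lhs => rw [hv]
    rw [sum_dotProduct]
    refine Finset.sum_eq_zero fun z hz => ?_
    rw [smul_dotProduct, hvz z hz, smul_zero]
  have hv0 : v = 0 := dotProduct_self_eq_zero.1 hvv
  have h0 : ∀ e : LandauFree H, (∑ y ∈ interiorSites H, φ y • gradVec H y) e = 0 := fun e => by
    rw [← hv, hv0]; rfl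
  exact eq_zero_of_sum_smul_gradVec_eq_zero φ h0 hx

/-- **The Hodge bilinear form of two columns is the kernel**: `Σ_r (λ_r·u_p)(λ_r·u_q) = λ_p·u_q` with `u_p = hodgeQ⁻¹λ_p`
(T-U1.G kills the gauge part of `u_p·hodgeQ u_q`). -/
theorem sum_landauCoeff_col_mul_col (p q : Plaq 4) :
    ∑ r ∈ hodgePlaqs H, (landauCoeff H r ⬝ᵥ ((hodgeQ H)⁻¹ *ᵥ landauCoeff H p)) * (landauCoeff H r ⬝ᵥ ((hodgeQ H)⁻¹ *ᵥ landauCoeff H q)) =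
      landauCoeff H p ⬝ᵥ ((hodgeQ H)⁻¹ *ᵥ landauCoeff H q) := by
  have hQu : hodgeQ H *ᵥ ((hodgeQ H)⁻¹ *ᵥ landauCoeff H q) = landauCoeff H q := by
    rw [mulVec_mulVec, mul_nonsing_inv _ (isUnit_hodgeQ_det H), one_mulVec]
  have h := dotProduct_hodgeQ_mulVec ((hodgeQ H)⁻¹ *ᵥ landauCoeff H p) ((hodgeQ H)⁻¹ *ᵥ landauCoeff H q)
  rw [hQu] at h
  have hgauge : ∑ x ∈ interiorSites H, (gradVec H x ⬝ᵥ ((hodgeQ H)⁻¹ *ᵥ landauCoeff H p)) *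
      (gradVec H x ⬝ᵥ ((hodgeQ H)⁻¹ *ᵥ landauCoeff H q)) = 0 :=
    Finset.sum_eq_zero fun x hx => by rw [gradVec_dotProduct_inv_mulVec_landauCoeff p hx, zero_mul]
  rw [hgauge, add_zero] at h
  rw [← h, dotProduct_mulVec, ← Matrix.mulVec_transpose, hodgeQ_inv_transpose, dotProduct_comm]

/-- **T-U1.P in the Hodge presentation**: the dipole kernel `K(p,q) = λ_pᵀ hodgeQ⁻¹ λ_q` is idempotent over `hodgePlaqs H`. -/
theorem hodgeKernel_idem (p q : Plaq 4) :
    ∑ r ∈ hodgePlaqs H, (landauCoeff H p ⬝ᵥ ((hodgeQ H)⁻¹ *ᵥ landauCoeff H r)) * (landauCoeff H r ⬝ᵥ ((hodgeQ H)⁻¹ *ᵥ landauCoeff H q)) =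
      landauCoeff H p ⬝ᵥ ((hodgeQ H)⁻¹ *ᵥ landauCoeff H q) := by
  have hsymm : ∀ r, landauCoeff H p ⬝ᵥ ((hodgeQ H)⁻¹ *ᵥ landauCoeff H r) = landauCoeff H r ⬝ᵥ ((hodgeQ H)⁻¹ *ᵥ landauCoeff H p) := by
    intro r
    rw [dotProduct_mulVec, ← Matrix.mulVec_transpose, hodgeQ_inv_transpose, dotProduct_comm]
  rw [Finset.sum_congr rfl fun r _ => by rw [hsymm r]]
  exact sum_landauCoeff_col_mul_col p q

/-- The diagonal of the Hodge dipole kernel is its ℓ²-row: `K(p,p) = Σ_r K(p,r)²`. -/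
theorem hodgeKernel_diag_eq_sum_sq (p : Plaq 4) :
    landauCoeff H p ⬝ᵥ ((hodgeQ H)⁻¹ *ᵥ landauCoeff H p) =
      ∑ r ∈ hodgePlaqs H, (landauCoeff H p ⬝ᵥ ((hodgeQ H)⁻¹ *ᵥ landauCoeff H r)) ^ 2 := by
  rw [← hodgeKernel_idem p p]
  refine Finset.sum_congr rfl fun r _ => ?_
  rw [sq, dotProduct_mulVec _ ((hodgeQ H)⁻¹) (landauCoeff H p), ← Matrix.mulVec_transpose, hodgeQ_inv_transpose, dotProduct_comm]

end Summit.QuantumFields.YangMills.Theorems.AllWindowsColdBoxBoxHighLine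

end
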